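import Summits.KontsevichZagierPeriods.KontsevichZagierPeriods.Theorems.SoloBlindTriplPrep
import Summits.KontsevichZagierPeriods.KontsevichZagierPeriods.Theorems.TerasomaMultiplicationReflectionThirdReps
import Literature.NumberTheory.Transcendental.FischlerRivoalCorollary1Reduction
import HarnessLib

/-!
# The Aoki–Shioda quartic family inside the Kontsevich–Zagier rules, I: the correspondence

(solo programme `solo-KontsevichZagierPeriods-blind`, session 11)

For rational `0 < x < 1/4` the Gamma identity
`B(x, 1-4x) - B(3x, 1-4x) = 2·64^{-x}·B(3x, 1/2 - x)`
(equivalently `B(x,3x) = 2^{2-6x} cos(πx) B(3x, ½-x)`: the two-term relation attached to the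
quartic family `(x, ½+x, ½+2x, -4x)` of Aoki–Shioda, i.e. the family `F₂` of Aoki's list of
isogeny families of Fermat motives) is realised by *one-dimensional* Kontsevich–Zagier moves along
an explicit rational correspondence between the `t`-line carrying `t^x(1-t)^{3x}` and the `s`-line
carrying `s^{3x}(1-s)^{-x-1/2}`.  With a parameter `m ∈ (0,1)` put
* `D(m) = m(m²-m+1)`, `A(m) = (1-m)(1+m²)` (so `A + D = 1`) and `Φ = D³/A⁴`;
* `φ_A = A` (decreasing, `|φ_A'| = 3m²-2m+1`) pulls `σ^{-4x}(1-σ)^{3x-1}dσ` (`B(1-4x,3x)`) back to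
  `Φ^x (3m²-2m+1)/D`;
* `φ_B = m³/(m²-m+1)` (increasing, `1-φ_B = A/(m²-m+1)`) pulls `σ^{x-1}(1-σ)^{-4x}dσ` (`B(x,1-4x)`)
  back to `Φ^x (m²-2m+3)/D`;
* `ψ = 4D/(1+m²)²` (increasing, `1-ψ = (1-m)⁴/(1+m²)²`) pulls `s^{3x-1}(1-s)^{-x-1/2}ds`
  (`B(3x,½-x)`) back to `64^x Φ^x (1-m²)/D`;

and `(m²-2m+3) = (3m²-2m+1) + 2(1-m²)` does the rest.  (Behind this: `t = 1/((1+μ)(1+μ²))`,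
`s = -4μ(1+μ+μ²)/(1+μ²)²` satisfy `s³ = -64·t(1-t)³·(1-s)`; `m = -μ` and `m = -1/μ` parametrise
the two real branches over `s ∈ (0,1)`, which is why no two-dimensional (Stokes) step is needed —
contrast the `S₃`-orbit relations.)

This file: the maps with their bijectivity data and the three pull-back identities (plus the
integrand additivity).  Part II (`SoloBlindQuartic`) transports integrability, checks
semialgebraicity and performs the moves in `Q`.
-/

noncomputable section

open Set MeasureTheory MvPolynomial

namespace Summit.KontsevichZagierPeriods.KontsevichZagierPeriods.Theorems

namespace SoloBlind

open Literature.ModelTheory.ExponentialFields (IsSemialgebraic)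
open Literature.NumberTheory.Transcendental
open Literature.NumberTheory.Transcendental.KZ

/-! ## The polynomials and the maps -/

/-- `D(m) = m(m²-m+1)`. -/
def quD (m : ℝ) : ℝ := m * (m ^ 2 - m + 1)

/-- `A(m) = (1-m)(1+m²)`; it is also the first substitution `φ_A`. -/
def quA (m : ℝ) : ℝ := (1 - m) * (1 + m ^ 2)

/-- `φ_A' = -(3m²-2m+1)`. -/
def quA' (m : ℝ) : ℝ := -(3 * m ^ 2 - 2 * m + 1)

/-- `Φ = D³/A⁴`. -/
def quPhi (m : ℝ) : ℝ := quD m ^ 3 / quA m ^ 4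

/-- `φ_B(m) = m³/(m²-m+1)`. -/
def quB (m : ℝ) : ℝ := m ^ 3 / (m ^ 2 - m + 1)

/-- `φ_B' = m²(m²-2m+3)/(m²-m+1)²`. -/
def quB' (m : ℝ) : ℝ := m ^ 2 * (m ^ 2 - 2 * m + 3) / (m ^ 2 - m + 1) ^ 2

/-- `ψ(m) = 4m(m²-m+1)/(1+m²)²`. -/
def quS (m : ℝ) : ℝ := 4 * (m * (m ^ 2 - m + 1)) / (1 + m ^ 2) ^ 2

/-- `ψ' = 4(1+m)(1-m)³/(1+m²)³`. -/
def quS' (m : ℝ) : ℝ := 4 * (1 + m) * (1 - m) ^ 3 / (1 + m ^ 2) ^ 3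

/-- The `m`-side integrand of `B(1-4x,3x)`: `Φ^x (3m²-2m+1)/D`. -/
def quGA (x : ℚ) (m : ℝ) : ℝ := quPhi m ^ (x : ℝ) * (3 * m ^ 2 - 2 * m + 1) / quD m

/-- The `m`-side integrand of `B(x,1-4x)`: `Φ^x (m²-2m+3)/D`. -/
def quGB (x : ℚ) (m : ℝ) : ℝ := quPhi m ^ (x : ℝ) * (m ^ 2 - 2 * m + 3) / quD m

/-- The `m`-side integrand of `B(3x,1/2-x)`: `64^x Φ^x (1-m²)/D`. -/
def quGC (x : ℚ) (m : ℝ) : ℝ := (64:ℝ) ^ (x : ℝ) * (quPhi m ^ (x : ℝ) * (1 - m ^ 2) / quD m)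

/-! ## Signs and elementary identities -/

/-- `D > 0` on `(0,1)`. -/
theorem quD_pos {m : ℝ} (hm : m ∈ Ioo (0:ℝ) 1) : 0 < quD m :=
  mul_pos hm.1 (ReflectionThird.sq_sub_add_one_pos m)

/-- `A > 0` on `(0,1)`. -/
theorem quA_pos {m : ℝ} (hm : m ∈ Ioo (0:ℝ) 1) : 0 < quA m :=
  mul_pos (by linarith [hm.2]) (by positivity)

/-- `A + D = 1`. -/
theorem quA_add_quD (m : ℝ) : quA m + quD m = 1 := by unfold quA quD; ring

/-- `1 - A = D`. -/
theorem one_sub_quA (m : ℝ) : 1 - quA m = quD m := by unfold quA quD; ring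

/-- `A ∈ (0,1)` on `(0,1)`. -/
theorem quA_mem {m : ℝ} (hm : m ∈ Ioo (0:ℝ) 1) : quA m ∈ Ioo (0:ℝ) 1 :=
  ⟨quA_pos hm, by linarith [quD_pos hm, quA_add_quD m]⟩

/-- `Φ > 0` on `(0,1)`. -/
theorem quPhi_pos {m : ℝ} (hm : m ∈ Ioo (0:ℝ) 1) : 0 < quPhi m := by
  have := quD_pos hm
  have := quA_pos hm
  unfold quPhi
  positivity

/-- `1 - φ_B = A/(m²-m+1)`. -/
theorem one_sub_quB (m : ℝ) : 1 - quB m = quA m / (m ^ 2 - m + 1) := by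
  have h := (ReflectionThird.sq_sub_add_one_pos m).ne'
  rw [quB, quA, eq_div_iff h, sub_mul, div_mul_cancel₀ _ h]
  ring

/-- `φ_B ∈ (0,1)` on `(0,1)`. -/
theorem quB_mem {m : ℝ} (hm : m ∈ Ioo (0:ℝ) 1) : quB m ∈ Ioo (0:ℝ) 1 := by
  have h0 := hm.1
  refine ⟨by unfold quB; exact div_pos (by positivity) (ReflectionThird.sq_sub_add_one_pos m), ?_⟩
  have h : 0 < 1 - quB m := by rw [one_sub_quB]; exact div_pos (quA_pos hm) (ReflectionThird.sq_sub_add_one_pos m)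
  linarith

/-- `1 - ψ = (1-m)⁴/(1+m²)²`. -/
theorem one_sub_quS (m : ℝ) : 1 - quS m = (1 - m) ^ 4 / (1 + m ^ 2) ^ 2 := by
  unfold quS
  field_simp
  ring

/-- `1 - ψ > 0` on `(0,1)`. -/
theorem one_sub_quS_pos {m : ℝ} (hm : m ∈ Ioo (0:ℝ) 1) : 0 < 1 - quS m := by
  have h1 : 0 < 1 - m := by linarith [hm.2]
  rw [one_sub_quS]
  positivity

/-- `ψ ∈ (0,1)` on `(0,1)`. -/
theorem quS_mem {m : ℝ} (hm : m ∈ Ioo (0:ℝ) 1) : quS m ∈ Ioo (0:ℝ) 1 := by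
  refine ⟨?_, by linarith [one_sub_quS_pos hm]⟩
  have h0 := hm.1
  have he := ReflectionThird.sq_sub_add_one_pos m
  unfold quS
  positivity

/-- `|φ_A'| = 3m²-2m+1`. -/
theorem abs_quA' (m : ℝ) : |quA' m| = 3 * m ^ 2 - 2 * m + 1 := by
  rw [quA', abs_neg, abs_of_pos (by nlinarith [sq_nonneg (m - 1)])]

/-- `φ_B' > 0` on `(0,1)`. -/
theorem quB'_pos {m : ℝ} (hm : m ∈ Ioo (0:ℝ) 1) : 0 < quB' m := by
  have h0 := hm.1
  have h3 : 0 < m ^ 2 - 2 * m + 3 := by nlinarith [sq_nonneg (m - 1)]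
  have he := ReflectionThird.sq_sub_add_one_pos m
  unfold quB'
  positivity

/-- `ψ' > 0` on `(0,1)`. -/
theorem quS'_pos {m : ℝ} (hm : m ∈ Ioo (0:ℝ) 1) : 0 < quS' m := by
  have h0 := hm.1
  have h1 : 0 < 1 - m := by linarith [hm.2]
  unfold quS'
  positivity

/-! ## Derivatives, injectivity, images -/

/-- `φ_A' ` is the derivative of `φ_A`. -/
theorem hasDerivAt_quA (m : ℝ) : HasDerivAt quA (quA' m) m := by
  have h1 : HasDerivAt (fun y : ℝ => 1 - y) (-1) m := by simpa using (hasDerivAt_id m).const_sub 1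
  have h2 : HasDerivAt (fun y : ℝ => 1 + y ^ 2) (2 * m) m := by
    simpa using (hasDerivAt_pow 2 m).const_add 1
  refine (h1.mul h2).congr_deriv ?_
  unfold quA'
  ring

/-- `φ_B' ` is the derivative of `φ_B`. -/
theorem hasDerivAt_quB (m : ℝ) : HasDerivAt quB (quB' m) m := by
  have h3 : HasDerivAt (fun y : ℝ => y ^ 3) (3 * m ^ 2) m := by simpa using hasDerivAt_pow 3 m
  have he : HasDerivAt (fun y : ℝ => y ^ 2 - y + 1) (2 * m - 1) m := by
    simpa using ((hasDerivAt_pow 2 m).sub (hasDerivAt_id m)).add_const 1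
  refine (h3.div he (ReflectionThird.sq_sub_add_one_pos m).ne').congr_deriv ?_
  unfold quB'
  field_simp
  ring

/-- `ψ' ` is the derivative of `ψ`. -/
theorem hasDerivAt_quS (m : ℝ) : HasDerivAt quS (quS' m) m := by
  have he : HasDerivAt (fun y : ℝ => y ^ 2 - y + 1) (2 * m - 1) m := by
    simpa using ((hasDerivAt_pow 2 m).sub (hasDerivAt_id m)).add_const 1
  have hn : HasDerivAt (fun y : ℝ => 4 * (y * (y ^ 2 - y + 1)))
      (4 * (1 * (m ^ 2 - m + 1) + m * (2 * m - 1))) m := ((hasDerivAt_id' m).mul he).const_mul 4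
  have h2 : HasDerivAt (fun y : ℝ => 1 + y ^ 2) (2 * m) m := by
    simpa using (hasDerivAt_pow 2 m).const_add 1
  have hd : HasDerivAt (fun y : ℝ => (1 + y ^ 2) ^ 2) (2 * (1 + m ^ 2) * (2 * m)) m :=
    (h2.fun_pow 2).congr_deriv (by norm_num)
  refine (hn.div hd (by positivity)).congr_deriv ?_
  unfold quS'
  field_simp
  ring

/-- `φ_A` is injective on `(0,1)`. -/
theorem injOn_quA : InjOn quA (Ioo (0:ℝ) 1) := by
  intro x hx y hy h
  unfold quA at h
  have h3 : (x - y) * (x ^ 2 + x * y + y ^ 2 - x - y + 1) = 0 := by linear_combination -h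
  have hne : x ^ 2 + x * y + y ^ 2 - x - y + 1 ≠ 0 := by
    nlinarith [sq_nonneg (x - 1 / 2), sq_nonneg (y - 1 / 2), mul_pos hx.1 hy.1]
  rcases mul_eq_zero.mp h3 with h4 | h4
  · linarith
  · exact (hne h4).elim

/-- `φ_B` is injective on `(0,1)`. -/
theorem injOn_quB : InjOn quB (Ioo (0:ℝ) 1) := by
  intro x hx y hy h
  unfold quB at h
  rw [div_eq_div_iff (ReflectionThird.sq_sub_add_one_pos x).ne' (ReflectionThird.sq_sub_add_one_pos y).ne'] at h
  have h3 : (x - y) * (x ^ 2 * (y ^ 2 - y + 1) + x * y * (1 - y) + y ^ 2) = 0 := by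
    linear_combination h
  have hpos : 0 < x ^ 2 * (y ^ 2 - y + 1) + x * y * (1 - y) + y ^ 2 := by
    have := mul_pos (pow_pos hx.1 2) (ReflectionThird.sq_sub_add_one_pos y)
    have := mul_pos (mul_pos hx.1 hy.1) (show (0:ℝ) < 1 - y by linarith [hy.2])
    have := pow_pos hy.1 2
    linarith
  rcases mul_eq_zero.mp h3 with h4 | h4
  · linarith
  · exact absurd h4 hpos.ne'

/-- `ψ` is injective on `(0,1)` (via `1 - ψ = ((1-m)²/(1+m²))²`). -/
theorem injOn_quS : InjOn quS (Ioo (0:ℝ) 1) := by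
  intro x hx y hy h
  have h1 : (1 - x) ^ 4 / (1 + x ^ 2) ^ 2 = (1 - y) ^ 4 / (1 + y ^ 2) ^ 2 := by
    rw [← one_sub_quS, ← one_sub_quS, h]
  rw [div_eq_div_iff (by positivity) (by positivity)] at h1
  have h2 : ((1 - x) ^ 2 * (1 + y ^ 2)) ^ 2 = ((1 - y) ^ 2 * (1 + x ^ 2)) ^ 2 := by
    linear_combination h1
  have h3 := (pow_left_inj₀ (by positivity) (by positivity) two_ne_zero).mp h2
  have h4 : (y - x) * (1 - x * y) = 0 := by linear_combination h3 / 2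
  have hne : 1 - x * y ≠ 0 := by nlinarith [mul_lt_mul'' hx.2 hy.2 hx.1.le hy.1.le]
  rcases mul_eq_zero.mp h4 with h5 | h5
  · linarith
  · exact (hne h5).elim

/-- `φ_A` maps `(0,1)` onto `(0,1)` (it is decreasing with `φ_A(0) = 1`, `φ_A(1) = 0`). -/
theorem image_quA : Ioo (0:ℝ) 1 = quA '' Ioo 0 1 := by
  refine Subset.antisymm ?_ ?_
  · have hc : Continuous quA := by unfold quA; fun_prop
    have h := intermediate_value_Ioo' zero_le_one hc.continuousOn
    rwa [show quA 1 = 0 by norm_num [quA], show quA 0 = 1 by norm_num [quA]] at h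
  · rintro w ⟨u, hu, rfl⟩
    exact quA_mem hu

/-- `φ_B` maps `(0,1)` onto `(0,1)`. -/
theorem image_quB : Ioo (0:ℝ) 1 = quB '' Ioo 0 1 := by
  refine Subset.antisymm ?_ ?_
  · have hc : Continuous quB := by
      unfold quB
      exact (by fun_prop : Continuous fun m : ℝ => m ^ 3).div (by fun_prop)
        fun m => (ReflectionThird.sq_sub_add_one_pos m).ne'
    have h := intermediate_value_Ioo zero_le_one hc.continuousOn
    rwa [show quB 0 = 0 by norm_num [quB], show quB 1 = 1 by norm_num [quB]] at h
  · rintro w ⟨u, hu, rfl⟩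
    exact quB_mem hu

/-- `ψ` maps `(0,1)` onto `(0,1)`. -/
theorem image_quS : Ioo (0:ℝ) 1 = quS '' Ioo 0 1 := by
  refine Subset.antisymm ?_ ?_
  · have hc : Continuous quS := by
      unfold quS
      exact (by fun_prop : Continuous fun m : ℝ => 4 * (m * (m ^ 2 - m + 1))).div (by fun_prop)
        fun m => by positivity
    have h := intermediate_value_Ioo zero_le_one hc.continuousOn
    rwa [show quS 0 = 0 by norm_num [quS], show quS 1 = 1 by norm_num [quS]] at h
  · rintro w ⟨u, hu, rfl⟩
    exact quS_mem hu

/-! ## The pull-back identities -/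

/-- `p^{jx+u} q^{kx+v} = (p^j q^k)^x · (p^u q^v)` for `p, q > 0`, `j, k ∈ ℤ`. -/
theorem qu_master {p q : ℝ} (hp : 0 < p) (hq : 0 < q) (x u v : ℝ) (j k : ℤ) :
    p ^ ((j : ℝ) * x + u) * q ^ ((k : ℝ) * x + v) = (p ^ j * q ^ k) ^ x * (p ^ u * q ^ v) := by
  rw [Real.rpow_add hp, Real.rpow_add hq, Real.rpow_intCast_mul hp.le,
    Real.rpow_intCast_mul hq.le, Real.mul_rpow (zpow_nonneg hp.le _) (zpow_nonneg hq.le _)]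
  ring

/-- `A^{-4} D³ = Φ`. -/
theorem qu_keyA {m : ℝ} (hm : m ∈ Ioo (0:ℝ) 1) : quA m ^ (-4:ℤ) * quD m ^ (3:ℤ) = quPhi m := by
  have hA := (quA_pos hm).ne'
  simp only [zpow_neg, zpow_ofNat, quPhi]
  field_simp

/-- `φ_B (1-φ_B)^{-4} = Φ`. -/
theorem qu_keyB {m : ℝ} (hm : m ∈ Ioo (0:ℝ) 1) :
    quB m ^ (1:ℤ) * (1 - quB m) ^ (-4:ℤ) = quPhi m := by
  have hA := (quA_pos hm).ne'
  have he := (ReflectionThird.sq_sub_add_one_pos m).ne'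
  have h0 := hm.1.ne'
  rw [one_sub_quB]
  simp only [zpow_neg, zpow_ofNat, quPhi, quB, quD]
  field_simp

/-- `ψ³ (1-ψ)^{-1} = 64 Φ`. -/
theorem qu_keyC {m : ℝ} (hm : m ∈ Ioo (0:ℝ) 1) :
    quS m ^ (3:ℤ) * (1 - quS m) ^ (-1:ℤ) = 64 * quPhi m := by
  have hA := (quA_pos hm).ne'
  have h1 : (1:ℝ) - m ≠ 0 := by linarith [hm.2]
  rw [one_sub_quS]
  simp only [zpow_neg, zpow_ofNat, quPhi, quS, quD, quA]
  field_simp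
  ring

/-- `(1-ψ)^{-1/2} = (1+m²)/(1-m)²` on `(0,1)`. -/
theorem qu_sqrtC {m : ℝ} (hm : m ∈ Ioo (0:ℝ) 1) :
    (1 - quS m) ^ (-(1 / 2 : ℝ)) = (1 + m ^ 2) / (1 - m) ^ 2 := by
  have h1 : (0:ℝ) < 1 - m := by linarith [hm.2]
  rw [one_sub_quS,
    show (1 - m) ^ 4 / (1 + m ^ 2) ^ 2 = ((1 - m) ^ 2 / (1 + m ^ 2)) ^ 2 by rw [div_pow, ← pow_mul],
    ← Real.rpow_natCast _ 2, ← Real.rpow_mul (by positivity),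
    show ((2:ℕ):ℝ) * (-(1 / 2 : ℝ)) = -1 by norm_num, Real.rpow_neg_one, inv_div]

/-- **Pull-back along `φ_A`:** `Φ^x(3m²-2m+1)/D = σ^{-4x}(1-σ)^{3x-1}|φ_A'|`, `σ = φ_A(m)`. -/
theorem qu_pullA (x : ℚ) {m : ℝ} (hm : m ∈ Ioo (0:ℝ) 1) :
    quGA x m = betaFun (1 - 4 * x) (3 * x) (quA m) * |quA' m| := by
  have hA := quA_pos hm
  have hD := quD_pos hm
  rw [betaFun, show (((1 - 4 * x : ℚ)) : ℝ) - 1 = ((-4:ℤ) : ℝ) * (x : ℝ) + 0 by push_cast; ring,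
    show (((3 * x : ℚ)) : ℝ) - 1 = ((3:ℤ) : ℝ) * (x : ℝ) + (-1) by push_cast; ring, one_sub_quA,
    qu_master hA hD, qu_keyA hm, Real.rpow_zero, Real.rpow_neg_one, abs_quA']
  unfold quGA
  rw [div_eq_mul_inv]
  ring

/-- **Pull-back along `φ_B`:** `Φ^x(m²-2m+3)/D = σ^{x-1}(1-σ)^{-4x}|φ_B'|`, `σ = φ_B(m)`. -/
theorem qu_pullB (x : ℚ) {m : ℝ} (hm : m ∈ Ioo (0:ℝ) 1) :
    quGB x m = betaFun x (1 - 4 * x) (quB m) * |quB' m| := by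
  have hB := quB_mem hm
  have h1B : 0 < 1 - quB m := by linarith [hB.2]
  have he := (ReflectionThird.sq_sub_add_one_pos m).ne'
  have h0 := hm.1.ne'
  rw [betaFun, show ((x : ℚ) : ℝ) - 1 = ((1:ℤ) : ℝ) * (x : ℝ) + (-1) by push_cast; ring,
    show (((1 - 4 * x : ℚ)) : ℝ) - 1 = ((-4:ℤ) : ℝ) * (x : ℝ) + 0 by push_cast; ring,
    qu_master hB.1 h1B, qu_keyB hm, Real.rpow_zero, Real.rpow_neg_one, abs_of_pos (quB'_pos hm)]
  unfold quGB quB quB' quD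
  field_simp

/-- **Pull-back along `ψ`:** `64^xΦ^x(1-m²)/D = s^{3x-1}(1-s)^{-x-1/2}|ψ'|`, `s = ψ(m)`. -/
theorem qu_pullC (x : ℚ) {m : ℝ} (hm : m ∈ Ioo (0:ℝ) 1) :
    quGC x m = betaFun (3 * x) (1 / 2 - x) (quS m) * |quS' m| := by
  have hS := quS_mem hm
  have h1S := one_sub_quS_pos hm
  have he := (ReflectionThird.sq_sub_add_one_pos m).ne'
  have h0 := hm.1.ne'
  have h1 : (1:ℝ) - m ≠ 0 := by linarith [hm.2]
  rw [betaFun, show (((3 * x : ℚ)) : ℝ) - 1 = ((3:ℤ) : ℝ) * (x : ℝ) + (-1) by push_cast; ring,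
    show (((1 / 2 - x : ℚ)) : ℝ) - 1 = ((-1:ℤ) : ℝ) * (x : ℝ) + (-(1 / 2 : ℝ)) by push_cast; ring,
    qu_master hS.1 h1S, qu_keyC hm, Real.mul_rpow (by norm_num) (quPhi_pos hm).le,
    Real.rpow_neg_one, qu_sqrtC hm, abs_of_pos (quS'_pos hm)]
  unfold quGC quS quS' quD
  field_simp
  ring

/-- **Integrand additivity:** `Φ^x(m²-2m+3)/D = Φ^x(3m²-2m+1)/D + 2·64^{-x}·(64^xΦ^x(1-m²)/D)`. -/
theorem qu_add (x : ℚ) (m : ℝ) :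
    quGB x m = quGA x m + 2 * (64:ℝ) ^ (-(x : ℝ)) * quGC x m := by
  have h64 : (0:ℝ) < (64:ℝ) ^ (x : ℝ) := by positivity
  unfold quGA quGB quGC
  rw [Real.rpow_neg (by norm_num)]
  field_simp
  ring

end SoloBlind

end Summit.KontsevichZagierPeriods.KontsevichZagierPeriods.Theorems
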